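import Mathlib
import Literature.NumberTheory.FibonacciNumbers.FibonacciLucasAdditionFormulas
import Literature.NumberTheory.FibonacciNumbers.FibonacciMultipleAngleFormulas

/-!
# Lucas numbers as moduli: Cohn's preliminary congruences (Cohn 1964, (6), (7), (10)–(12))

Topic `NumberTheory/FibonacciNumbers`; theorems only — no definition, no named fact. `F_n` is Mathlib's
`Nat.fib`, `L_n` is the tree's `lucas` (`ContinuedFractions/FibonacciLucasNumbers.lean`).

SOURCE (open scan, read by eye): J. H. E. Cohn, *Square Fibonacci numbers, etc.*, Fibonacci Quart. **2**
(1964) 109–113 [Cohn1964], § PRELIMINARIES (pp. 109–110), VERBATIM: «Throughout the following n, m, k will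
denote integers, not necessarily positive, and r will denote a non-negative integer. Also, wherever it
occurs, k will denote an even integer, not divisible by 3. We shall then require the following formulae,
all of which are elementary
(1) `2F_{m+n} = F_m L_n + F_n L_m` (2) `2L_{m+n} = 5F_m F_n + L_m L_n` (3) `L_{2m} = L_m² + (−1)^{m−1} 2`
(4) `(F_{3m}, L_{3m}) = 2` (5) `(F_n, L_n) = 1` if `3 ∤ n` (6) `2 | L_m` if and only if `3 | m`
(7) `3 | L_m` if and only if `m ≡ 2 (mod 4)` (8) `F_{−n} = (−1)^{n−1} F_n` (9) `L_{−n} = (−1)^n L_n`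
(10) `L_k ≡ 3 (mod 4)` if `2 | k, 3 ∤ k` (11) `L_{m+2k} ≡ −L_m (mod L_k)` (12) `F_{m+2k} ≡ −F_m (mod L_k)`
(13) `L_{m+12} ≡ L_m (mod 8)`» and, in the proofs of Theorems 1–4 (pp. 110–112): «`−1` is a non-residue of
`L_k` by (10)», «`−36` is a non-residue of `L_k` using (7) and (10)» (there `4 | k, 3 ∤ k`).

## What is typed here, and how

* (1), (2), (3), (4)/(5), (13) ARE the tree's `two_mul_fib_add`, `two_mul_lucas_add`, `lucas_two_mul_add`,
  `gcd_fib_lucas` (`= (F_n, 2)`), `lucas_add_twelve_modEq_eight` — cited, not restated. (8), (9) concern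
  negative indices and are not typed (we stay on `ℕ`; see the last bullet).
* (6) `two_dvd_lucas_iff` (via the period `3` of `L` modulo `2`; equivalently the tree's `even_lucas_iff`
  with `AdditiveGenerator.FibonacciModTwoPow.even_fib_iff`, not imported here), (7) `three_dvd_lucas_iff`
  (via the period `8` of `L` modulo `3`, `lucas_add_eight_modEq_three`), (10) `lucas_mod_four` (via the period `6` of `L` modulo `4`,
  `lucas_add_six_modEq_four`); «using (7) and (10)»: `coprime_six_lucas` (`(6, L_k) = 1` for `4 | k, 3 ∤ k`),
  `odd_lucas` (`L_k` odd for `3 ∤ k`).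
* (11), (12) for EVEN `k` only (the hypothesis `3 ∤ k` is not needed for them): `lucas_add_two_mul_modEq_neg`,
  `fib_add_two_mul_modEq_neg`, read off the tree's (17a) `L_{m+2k} + (−1)^k L_m = L_k L_{m+k}` and (15a)
  `F_{m+2k} + (−1)^k F_m = L_k F_{m+k}` [Vajda1989]; and the ITERATED forms Cohn uses («`n = c + 2·3^r·k` …
  `L_n ≡ −L_c (mod L_k)`»): `lucas_add_two_mul_mul_modEq_neg`, `fib_add_two_mul_mul_modEq_neg`
  (`X_{m+2kt} ≡ −X_m (mod L_k)` for `k` even, `t` odd; via `L_k | L_{tk}`, the tree's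
  `lucas_dvd_lucas_mul_of_odd`).
* «`−1` is a non-residue of `L_k`»: `not_isSquare_neg_one_zmod_of_mod_four_eq_three` (any `N ≡ 3 (mod 4)`
  has a prime factor `≡ 3 (mod 4)`, then Mathlib's `Nat.mod_four_ne_three_of_mem_primeFactors_of_isSquare_neg_one`)
  and the working form `not_sq_modEq_neg_sq` (`x² ≢ −c² (mod N)` for `N ≡ 3 (mod 4)`, `(c, N) = 1`; Cohn's
  `c = 1, 2, 6`).
* NEGATIVE INDICES. Cohn applies (11), (12) also with `k < 0` and to `F_{−n}, L_{−n}` through (8), (9). On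
  `ℕ` the same identities (17a), (15b) give the REFLECTED congruences he needs: if `a + b = 2kt` (`k` even,
  `t` odd, `b ≤ a`) then `L_a ≡ −(−1)^b L_b` and `F_a ≡ (−1)^b F_b (mod L_k)` (`lucas_modEq_of_add_eq`,
  `fib_modEq_of_add_eq`); this is our deviation from the printed route, used in
  `SquareFibonacciNumbers.lean` in place of (8), (9).

## References
* [Cohn1964] J. H. E. Cohn, *Square Fibonacci numbers, etc.*, Fibonacci Quart. 2 (1964) 109–113, (1)–(13).
* [Vajda1989] S. Vajda, *Fibonacci & Lucas Numbers, and the Golden Section*, Ellis Horwood 1989, Ch. III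
  (15a), (15b), (17a) (the tree's `FibonacciLucasAdditionFormulas.lean`).
-/

namespace Literature.NumberTheory.FibonacciNumbers

open Nat Literature.NumberTheory.ContinuedFractions.FibonacciLucas

/-! ### (6), (7), (10): `L_m` modulo `2`, `3`, `4` -/

/-- The Lucas numbers modulo `2` have period `3` (used for (6)). [cite: Cohn1964, (6)] -/
theorem lucas_add_three_modEq_two (n : ℕ) : lucas (n + 3) ≡ lucas n [MOD 2] := by
  induction n using Nat.twoStepInduction with
  | zero => decide
  | one => decide
  | more n h0 h1 =>
    rw [show n + 2 + 3 = (n + 3) + 2 from rfl, lucas_add_two, lucas_add_two]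
    exact h0.add h1

/-- **(6)** «`2 | L_m` if and only if `3 | m`» (equivalently: the tree's `even_lucas_iff` with `even_fib_iff`).
[cite: Cohn1964, (6)] -/
theorem two_dvd_lucas_iff (m : ℕ) : 2 ∣ lucas m ↔ 3 ∣ m := by
  induction m using Nat.strong_induction_on with
  | _ m ih =>
    rcases lt_or_ge m 3 with h | h
    · interval_cases m <;> decide
    · obtain ⟨k, rfl⟩ : ∃ k, m = k + 3 := ⟨m - 3, by omega⟩
      rw [(lucas_add_three_modEq_two k).dvd_iff dvd_rfl, ih k (by omega)]
      omega

/-- (6), contrapositive form used with «`k` … not divisible by 3»: `L_k` is odd when `3 ∤ k`.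
[cite: Cohn1964, (6)] -/
theorem odd_lucas {k : ℕ} (h3 : ¬3 ∣ k) : Odd (lucas k) := by
  rw [← Nat.not_even_iff_odd, even_iff_two_dvd, two_dvd_lucas_iff]
  exact h3

/-- The Lucas numbers modulo `3` have period `8` (used for (7)). [cite: Cohn1964, (7)] -/
theorem lucas_add_eight_modEq_three (n : ℕ) : lucas (n + 8) ≡ lucas n [MOD 3] := by
  induction n using Nat.twoStepInduction with
  | zero => decide
  | one => decide
  | more n h0 h1 =>
    rw [show n + 2 + 8 = (n + 8) + 2 from rfl, lucas_add_two, lucas_add_two]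
    exact h0.add h1

/-- **(7)** «`3 | L_m` if and only if `m ≡ 2 (mod 4)`». [cite: Cohn1964, (7)] -/
theorem three_dvd_lucas_iff (m : ℕ) : 3 ∣ lucas m ↔ m % 4 = 2 := by
  induction m using Nat.strong_induction_on with
  | _ m ih =>
    rcases lt_or_ge m 8 with h | h
    · interval_cases m <;> decide
    · obtain ⟨k, rfl⟩ : ∃ k, m = k + 8 := ⟨m - 8, by omega⟩
      rw [(lucas_add_eight_modEq_three k).dvd_iff dvd_rfl, ih k (by omega)]
      omega

/-- The Lucas numbers modulo `4` have period `6` (used for (10)). [cite: Cohn1964, (10)] -/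
theorem lucas_add_six_modEq_four (n : ℕ) : lucas (n + 6) ≡ lucas n [MOD 4] := by
  induction n using Nat.twoStepInduction with
  | zero => decide
  | one => decide
  | more n h0 h1 =>
    rw [show n + 2 + 6 = (n + 6) + 2 from rfl, lucas_add_two, lucas_add_two]
    exact h0.add h1

/-- **(10)** «`L_k ≡ 3 (mod 4)` if `2 | k, 3 ∤ k`». [cite: Cohn1964, (10)] -/
theorem lucas_mod_four {k : ℕ} (h2 : 2 ∣ k) (h3 : ¬3 ∣ k) : lucas k % 4 = 3 := by
  induction k using Nat.strong_induction_on with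
  | _ k ih =>
    rcases lt_or_ge k 6 with h | h
    · interval_cases k <;> simp_all <;> decide
    · obtain ⟨j, rfl⟩ : ∃ j, k = j + 6 := ⟨k - 6, by omega⟩
      rw [lucas_add_six_modEq_four j]
      exact ih j (by omega) (by omega) (by omega)

/-- «using (7) and (10)» (proof of Theorem 2, where «`4 | k, 3 ∤ k`»): then `(6, L_k) = 1`.
[cite: Cohn1964, (6)–(7) (proof of Thm 2)] -/
theorem coprime_six_lucas {k : ℕ} (h4 : 4 ∣ k) (h3 : ¬3 ∣ k) : Nat.Coprime 6 (lucas k) := by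
  rw [show (6 : ℕ) = 2 * 3 from rfl]
  refine Nat.Coprime.mul_left ?_ ?_
  · exact Nat.coprime_two_left.mpr (odd_lucas h3)
  · refine (Nat.Prime.coprime_iff_not_dvd Nat.prime_three).mpr fun h => ?_
    rw [three_dvd_lucas_iff] at h
    omega

/-! ### (11), (12): `L_{m+2k} ≡ −L_m`, `F_{m+2k} ≡ −F_m (mod L_k)` for even `k`, and their iterates -/

/-- **(11)** «`L_{m+2k} ≡ −L_m (mod L_k)`» for even `k` (from (17a) `L_{m+2k} + (−1)^k L_m = L_k L_{m+k}`).
[cite: Cohn1964, (11)] -/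
theorem lucas_add_two_mul_modEq_neg (m : ℕ) {k : ℕ} (hk : Even k) :
    (lucas (m + 2 * k) : ℤ) ≡ -(lucas m : ℤ) [ZMOD lucas k] := by
  have h := lucas_add_two_mul_add m k
  rw [hk.neg_one_pow, one_mul] at h
  exact Int.modEq_iff_dvd.mpr ⟨-(lucas (m + k) : ℤ), by linear_combination -h⟩

/-- **(12)** «`F_{m+2k} ≡ −F_m (mod L_k)`» for even `k` (from (15a) `F_{m+2k} + (−1)^k F_m = L_k F_{m+k}`).
[cite: Cohn1964, (12)] -/
theorem fib_add_two_mul_modEq_neg (m : ℕ) {k : ℕ} (hk : Even k) :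
    (fib (m + 2 * k) : ℤ) ≡ -(fib m : ℤ) [ZMOD lucas k] := by
  have h := fib_add_two_mul_add m k
  rw [hk.neg_one_pow, one_mul] at h
  exact Int.modEq_iff_dvd.mpr ⟨-(fib (m + k) : ℤ), by linear_combination -h⟩

/-- (11) iterated an odd number `t` of times, as used in «`n = 1 + 2·3^r·k` … and then obtain by (11)
`L_n ≡ −L_1`»: `L_{m+2kt} ≡ −L_m (mod L_k)` for `k` even, `t` odd (via `L_k | L_{tk}`).
[cite: Cohn1964, (11) (proof of Thm 1)] -/
theorem lucas_add_two_mul_mul_modEq_neg (m : ℕ) {k t : ℕ} (hk : Even k) (ht : Odd t) :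
    (lucas (m + 2 * k * t) : ℤ) ≡ -(lucas m : ℤ) [ZMOD lucas k] := by
  have h := lucas_add_two_mul_add m (t * k)
  rw [(hk.mul_left t).neg_one_pow, one_mul, show m + 2 * (t * k) = m + 2 * k * t by ring] at h
  obtain ⟨c, hc⟩ := lucas_dvd_lucas_mul_of_odd k ht
  refine Int.modEq_iff_dvd.mpr ⟨-(c * lucas (m + t * k) : ℤ), ?_⟩
  have hc' : (lucas (t * k) : ℤ) = lucas k * c := by exact_mod_cast hc
  linear_combination -h - (lucas (m + t * k) : ℤ) * hc'

/-- (12) iterated an odd number `t` of times, as used in «`n = 1 + 2·3^r·k` and so `F_n ≡ −F_1`»: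
`F_{m+2kt} ≡ −F_m (mod L_k)` for `k` even, `t` odd. [cite: Cohn1964, (12) (proof of Thm 3)] -/
theorem fib_add_two_mul_mul_modEq_neg (m : ℕ) {k t : ℕ} (hk : Even k) (ht : Odd t) :
    (fib (m + 2 * k * t) : ℤ) ≡ -(fib m : ℤ) [ZMOD lucas k] := by
  have h := fib_add_two_mul_add m (t * k)
  rw [(hk.mul_left t).neg_one_pow, one_mul, show m + 2 * (t * k) = m + 2 * k * t by ring] at h
  obtain ⟨c, hc⟩ := lucas_dvd_lucas_mul_of_odd k ht
  refine Int.modEq_iff_dvd.mpr ⟨-(c * fib (m + t * k) : ℤ), ?_⟩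
  have hc' : (lucas (t * k) : ℤ) = lucas k * c := by exact_mod_cast hc
  linear_combination -h - (fib (m + t * k) : ℤ) * hc'

/-! ### Reflected forms (our replacement for (8), (9)): indices `a, b` with `a + b = 2kt` -/

/-- The sign bookkeeping: if `j + b` is even then `(−1)^j = (−1)^b`. -/
@[folklore] private theorem neg_one_pow_eq_of_even_add {j b : ℕ} (h : Even (j + b)) :
    (-1 : ℤ) ^ j = (-1) ^ b := by
  rcases Nat.even_or_odd b with hb | hb
  · rw [hb.neg_one_pow, ((Nat.even_add.mp h).mpr hb).neg_one_pow]
  · have hj : Odd j := by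
      rw [← Nat.not_even_iff_odd]
      exact fun hj => (Nat.not_even_iff_odd.mpr hb) ((Nat.even_add.mp h).mp hj)
    rw [hb.neg_one_pow, hj.neg_one_pow]

/-- Reflected (11): if `a + b = 2kt` with `k` even, `t` odd and `b ≤ a`, then `L_a ≡ −(−1)^b L_b (mod L_k)`
(from (17a) with `m = b` and shift `(a − b)/2 = kt − b`: `L_a + (−1)^{kt−b} L_b = L_{kt−b} L_{kt}`, and
`L_k | L_{kt}`). Cohn obtains this case from (9) `L_{−n} = (−1)^n L_n` and (11) with a negative `k`.
[cite: Cohn1964, (9), (11) (proof of Thm 2, «Finally, if `n ≡ 2 (mod 8)`»)] -/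
theorem lucas_modEq_of_add_eq {a b k t : ℕ} (hk : Even k) (ht : Odd t) (hab : a + b = 2 * k * t)
    (hba : b ≤ a) : (lucas a : ℤ) ≡ -((-1) ^ b * lucas b : ℤ) [ZMOD lucas k] := by
  rw [show 2 * k * t = 2 * (t * k) by ring] at hab
  obtain ⟨j, hj⟩ : ∃ j, j = t * k - b := ⟨_, rfl⟩
  have hbj : b + j = t * k := by omega
  have ha : a = b + 2 * j := by omega
  have h := lucas_add_two_mul_add b j
  rw [← ha, hbj, neg_one_pow_eq_of_even_add (j := j) (b := b) (by rw [add_comm, hbj]; exact hk.mul_left t)]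
    at h
  obtain ⟨c, hc⟩ := lucas_dvd_lucas_mul_of_odd k ht
  have hc' : (lucas (t * k) : ℤ) = lucas k * c := by exact_mod_cast hc
  refine Int.modEq_iff_dvd.mpr ⟨-(c * lucas j : ℤ), ?_⟩
  linear_combination -h - (lucas j : ℤ) * hc'

/-- Reflected (12): if `a + b = 2kt` with `k` even, `t` odd and `b ≤ a`, then `F_a ≡ (−1)^b F_b (mod L_k)`
(from (15b) `F_{b+2j} − (−1)^j F_b = F_j L_{b+j}` with `b + j = kt`, and `L_k | L_{kt}`). Cohn obtains this
case from (8) `F_{−n} = (−1)^{n−1} F_n` and (12) with a negative `k`.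
[cite: Cohn1964, (8), (12) (proofs of Thms 3, 4, «`F_{−n} = F_n`»)] -/
theorem fib_modEq_of_add_eq {a b k t : ℕ} (hk : Even k) (ht : Odd t) (hab : a + b = 2 * k * t)
    (hba : b ≤ a) : (fib a : ℤ) ≡ (-1) ^ b * fib b [ZMOD lucas k] := by
  rw [show 2 * k * t = 2 * (t * k) by ring] at hab
  obtain ⟨j, hj⟩ : ∃ j, j = t * k - b := ⟨_, rfl⟩
  have hbj : b + j = t * k := by omega
  have ha : a = b + 2 * j := by omega
  have h := fib_add_two_mul_sub b j
  rw [← ha, hbj, neg_one_pow_eq_of_even_add (j := j) (b := b) (by rw [add_comm, hbj]; exact hk.mul_left t)]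
    at h
  obtain ⟨c, hc⟩ := lucas_dvd_lucas_mul_of_odd k ht
  have hc' : (lucas (t * k) : ℤ) = lucas k * c := by exact_mod_cast hc
  refine Int.modEq_iff_dvd.mpr ⟨-(c * fib j : ℤ), ?_⟩
  linear_combination -h - (fib j : ℤ) * hc'

/-! ### «`−1` is a non-residue of `L_k`» -/

/-- A natural number `≡ 3 (mod 4)` has a prime factor `≡ 3 (mod 4)`. -/
@[folklore] private theorem exists_prime_dvd_mod_four_eq_three {N : ℕ} (h : N % 4 = 3) :
    ∃ p, p.Prime ∧ p ∣ N ∧ p % 4 = 3 := by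
  induction N using Nat.strong_induction_on with
  | _ N ih =>
    obtain ⟨p, hpp, hpN⟩ := Nat.exists_prime_and_dvd (show N ≠ 1 by omega)
    by_cases hp3 : p % 4 = 3
    · exact ⟨p, hpp, hpN, hp3⟩
    · obtain ⟨q, hq⟩ := hpN
      have hp2 : ¬2 ∣ p := fun h2 => by
        have h2N : 2 ∣ N := dvd_trans h2 ⟨q, hq⟩
        omega
      have hp1 : p % 4 = 1 := by omega
      have hq3 : q % 4 = 3 := by
        have hmul : N % 4 = (p % 4) * (q % 4) % 4 := by rw [hq]; exact Nat.mul_mod p q 4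
        rw [hp1, one_mul, Nat.mod_mod] at hmul
        omega
      have hq0 : 0 < q := by
        rcases Nat.eq_zero_or_pos q with hq0 | hq0
        · rw [hq0, mul_zero] at hq; omega
        · exact hq0
      have hqN : q < N := by
        rw [hq]
        exact lt_mul_left hq0 hpp.one_lt
      obtain ⟨r, hr, hrq, hr3⟩ := ih q hqN hq3
      exact ⟨r, hr, hq ▸ dvd_mul_of_dvd_right hrq p, hr3⟩

/-- «`−1` is a non-residue of `L_k` by (10)», in general: `−1` is not a square modulo any `N ≡ 3 (mod 4)`.
[cite: Cohn1964, (10) (proof of Thm 1)] -/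
theorem not_isSquare_neg_one_zmod_of_mod_four_eq_three {N : ℕ} (h : N % 4 = 3) :
    ¬IsSquare (-1 : ZMod N) := by
  intro hs
  obtain ⟨p, hp, hpN, hp3⟩ := exists_prime_dvd_mod_four_eq_three h
  have hN0 : N ≠ 0 := by rintro rfl; omega
  exact Nat.mod_four_ne_three_of_mem_primeFactors_of_isSquare_neg_one
    (Nat.mem_primeFactors.mpr ⟨hp, hpN, hN0⟩) hs hp3

/-- The working form of «`−1` is a non-residue», «`2L_n ≡ −4 (mod L_k)` whence `2L_n ≠ y²`», «`−36` is a
non-residue of `L_k`»: if `N ≡ 3 (mod 4)` and `(c, N) = 1` then `x² ≢ −c² (mod N)`.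
[cite: Cohn1964, (10) (proofs of Thms 1–4)] -/
theorem not_sq_modEq_neg_sq {N : ℕ} (hN : N % 4 = 3) {c : ℕ} (hc : Nat.Coprime c N) (x : ℤ) :
    ¬(x ^ 2 ≡ -((c : ℤ) ^ 2) [ZMOD (N : ℤ)]) := by
  intro h
  apply not_isSquare_neg_one_zmod_of_mod_four_eq_three hN
  have hNpos : 0 < N := by omega
  haveI : NeZero N := ⟨hNpos.ne'⟩
  have h' : ((x : ZMod N)) ^ 2 = -((c : ZMod N)) ^ 2 := by
    have := (ZMod.intCast_eq_intCast_iff_dvd_sub _ _ N).mpr (Int.ModEq.dvd h.symm)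
    · push_cast at this
      linear_combination -this
  set u := ZMod.unitOfCoprime c hc with hu
  refine ⟨(x : ZMod N) * (u⁻¹ : (ZMod N)ˣ), ?_⟩
  have hcu : (c : ZMod N) = (u : ZMod N) := by rw [hu, ZMod.coe_unitOfCoprime]
  rw [hcu] at h'
  calc (-1 : ZMod N) = -1 * ((u : ZMod N) * (u⁻¹ : (ZMod N)ˣ)) ^ 2 := by
        rw [Units.mul_inv, one_pow, mul_one]
    _ = -(u : ZMod N) ^ 2 * ((u⁻¹ : (ZMod N)ˣ) : ZMod N) ^ 2 := by ring
    _ = (x : ZMod N) ^ 2 * ((u⁻¹ : (ZMod N)ˣ) : ZMod N) ^ 2 := by rw [h']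
    _ = (x : ZMod N) * (u⁻¹ : (ZMod N)ˣ) * ((x : ZMod N) * (u⁻¹ : (ZMod N)ˣ)) := by ring

/-- The case `c = 1`: `x² ≢ −1 (mod L_k)` for `2 | k, 3 ∤ k` («and so `L_n ≠ x²` since `−1` is a non-residue
of `L_k` by (10)»). [cite: Cohn1964, (10) (proof of Thm 1)] -/
theorem not_sq_modEq_neg_one_lucas {k : ℕ} (h2 : 2 ∣ k) (h3 : ¬3 ∣ k) (x : ℤ) :
    ¬(x ^ 2 ≡ -1 [ZMOD (lucas k : ℤ)]) := by
  have h := not_sq_modEq_neg_sq (lucas_mod_four h2 h3) (Nat.coprime_one_left (lucas k)) x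
  simpa using h

/-- The case `c = 2`: `x² ≢ −4 (mod L_k)` for `2 | k, 3 ∤ k` («`L_n ≡ −L_3 = −4 (mod L_k)` and again
`L_n ≠ x²`»; «`2L_n ≡ −2L_0 = −4 (mod L_k)` whence `2L_n ≠ y²`»). [cite: Cohn1964, (10) (proofs of Thms 1, 2, 4)] -/
theorem not_sq_modEq_neg_four_lucas {k : ℕ} (h2 : 2 ∣ k) (h3 : ¬3 ∣ k) (x : ℤ) :
    ¬(x ^ 2 ≡ -4 [ZMOD (lucas k : ℤ)]) := by
  have hc : Nat.Coprime 2 (lucas k) := Nat.coprime_two_left.mpr (odd_lucas h3)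
  have h := not_sq_modEq_neg_sq (lucas_mod_four h2 h3) hc x
  norm_num at h
  exact h

/-- The case `c = 6`: `x² ≢ −36 (mod L_k)` for `4 | k, 3 ∤ k` («`−36` is a non-residue of `L_k` using (7)
and (10)»). [cite: Cohn1964, (7), (10) (proof of Thm 2)] -/
theorem not_sq_modEq_neg_thirtySix_lucas {k : ℕ} (h4 : 4 ∣ k) (h3 : ¬3 ∣ k) (x : ℤ) :
    ¬(x ^ 2 ≡ -36 [ZMOD (lucas k : ℤ)]) := by
  have h2 : 2 ∣ k := dvd_trans (by norm_num) h4
  have h := not_sq_modEq_neg_sq (lucas_mod_four h2 h3) (coprime_six_lucas h4 h3) x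
  norm_num at h
  exact h

end Literature.NumberTheory.FibonacciNumbers
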